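import Mathlib
import Literature.NumberTheory.DiophantineGeometry.GLPolynomialRepSemisimpleProofs

/-!
# Stub S5 for `GLnSeparatingDesigns.SeparationDegreeCost` (line `SketchIdeator1`):
# the span of the restricted right translations is no bigger than the host module

For `V = ℂ[x_{ij}]_{≤ s}` (`MvPolynomial.restrictTotalDegree (Fin n × Fin n) ℂ s`) and the right
translations `R_g = matTransl (Fin n) ℂ g` (`(R_g p)(x) = p(x g)`, tree file
`Literature/NumberTheory/DiophantineGeometry/GLPolynomialRepSemisimpleProofs`), the span of the
restrictions `R_g|_V : V → ℂ[x_{ij}]`, `g ∈ GL_n(ℂ)`, has rank at most `rank V`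
(`stub_rank_span_matTransl_domRestrict_le`).

Proof (duality through evaluation at the identity matrix): the linear map `T ↦ (p ↦ (T p)(1))`
from that span to the dual space `V^*` is injective. Indeed every `T` in the span satisfies
`(T p)(x) = (T (L_x p))(1)` for all matrices `x`, where `(L_x p)(y) = p(x y)` is the left
substitution `X (i, j) ↦ ∑ l, x (i, l) • X (l, j)` (again of degree `≤ s`); this identity is linear
in `T` and holds for `T = R_g|_V` because both sides equal `p(x g)`. Hence if `(T q)(1) = 0` for all
`q ∈ V`, then all values of the polynomial `T p` vanish, so `T p = 0` (`MvPolynomial.funext`, `ℂ` is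
infinite). Finally `rank V^* = rank V` since `V` is finite-dimensional.
-/

-- `Summit.MatrixMultiplication.MatrixMultiplication.…` is the tree's mandated summit-side namespace (Sub = Summit), flagged by `dupNamespace`.
set_option linter.dupNamespace false

noncomputable section

open scoped BigOperators
open Literature.NumberTheory.DiophantineGeometry MvPolynomial

namespace Summit.MatrixMultiplication.MatrixMultiplication.Theorems

/-- Left substitution `X (i, j) ↦ ∑ l, x (i, l) • X (l, j)` evaluates as `(L_x P)(y) = P(x y)`.
[folklore] -/
private theorem eval_aeval_leftSubst {σ k : Type*} [Fintype σ] [CommRing k] (x y : σ × σ → k)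
    (P : MvPolynomial (σ × σ) k) :
    eval y (aeval (fun ij : σ × σ => (∑ l, x (ij.1, l) • X (l, ij.2) : MvPolynomial (σ × σ) k)) P) =
      eval (fun ij : σ × σ => ∑ l, x (ij.1, l) * y (l, ij.2)) P := by
  have h : (aeval y).comp
      (aeval fun ij : σ × σ => (∑ l, x (ij.1, l) • X (l, ij.2) : MvPolynomial (σ × σ) k)) =
      aeval (fun ij : σ × σ => ∑ l, x (ij.1, l) * y (l, ij.2)) := by
    refine MvPolynomial.algHom_ext fun ij => ?_
    simp only [AlgHom.comp_apply, aeval_X, map_sum, map_smul, smul_eq_mul]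
  have h' := congrArg (fun φ => φ P) h
  simpa only [AlgHom.comp_apply, MvPolynomial.aeval_eq_eval] using h'

/-- Left substitution does not increase the total degree (the substituted polynomials
`∑ l, x (i, l) • X (l, j)` have total degree `≤ 1`). [folklore] -/
private theorem totalDegree_aeval_leftSubst_le {σ k : Type*} [Fintype σ] [CommRing k]
    [Nontrivial k] (x : σ × σ → k) (P : MvPolynomial (σ × σ) k) :
    (aeval (fun ij : σ × σ => (∑ l, x (ij.1, l) • X (l, ij.2) : MvPolynomial (σ × σ) k))
      P).totalDegree ≤ P.totalDegree := by
  classical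
  have hL : ∀ ij : σ × σ,
      (∑ l, x (ij.1, l) • X (l, ij.2) : MvPolynomial (σ × σ) k).totalDegree ≤ 1 :=
    fun ij => totalDegree_finsetSum_le fun l _ =>
      (totalDegree_smul_le _ _).trans (totalDegree_X _).le
  rw [aeval_eq_bind₁]
  conv_lhs => rw [P.as_sum]
  rw [map_sum]
  refine totalDegree_finsetSum_le fun m hm => ?_
  rw [bind₁_monomial]
  refine (totalDegree_mul _ _).trans ?_
  rw [totalDegree_C, zero_add]
  refine (totalDegree_finsetProd _ _).trans ?_
  refine le_trans (Finset.sum_le_sum fun c _ => (totalDegree_pow _ _).trans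
    (Nat.mul_le_mul_left (m c) (hL c))) ?_
  simp only [mul_one]
  exact le_totalDegree hm

/-- Evaluating a right translate at the identity matrix: `(R_g q)(1) = q(g)`. [folklore] -/
private theorem eval_one_matTransl {σ k : Type*} [Fintype σ] [DecidableEq σ] [CommRing k]
    (g : Matrix σ σ k) (q : MvPolynomial (σ × σ) k) :
    eval (fun ij : σ × σ => (1 : Matrix σ σ k) ij.1 ij.2) (matTransl σ k g q) =
      eval (fun ij : σ × σ => g ij.1 ij.2) q := by
  rw [eval_matTransl]
  refine congrArg (fun f : σ × σ → k => eval f q) ?_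
  funext ij
  simp [Matrix.one_apply]

/-- For a right translation both `(R_g p)(x)` and `(R_g (L_x p))(1)` equal `p(x g)`. [folklore] -/
private theorem eval_matTransl_eq_eval_one {σ k : Type*} [Fintype σ] [DecidableEq σ] [CommRing k]
    (g : Matrix σ σ k) {e : σ × σ → k} (he : e = fun ij : σ × σ => (1 : Matrix σ σ k) ij.1 ij.2)
    {x : σ × σ → k} {L : MvPolynomial (σ × σ) k →ₐ[k] MvPolynomial (σ × σ) k}
    (hL : L = aeval (fun ij : σ × σ => (∑ l, x (ij.1, l) • X (l, ij.2) : MvPolynomial (σ × σ) k)))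
    (p : MvPolynomial (σ × σ) k) :
    eval x (matTransl σ k g p) = eval e (matTransl σ k g (L p)) := by
  subst he hL
  rw [eval_one_matTransl, eval_aeval_leftSubst, eval_matTransl]

/-- Abstract form of the stub: if a finite-dimensional subspace `V ⊆ ℂ[x_{ij}]` is stable under
the left substitutions `L_x`, then the span of the restricted right translations `R_g|_V`,
`g ∈ GL_n(ℂ)`, has rank at most `rank V`: the map `T ↦ (p ↦ (T p)(1))` into `V^*` is injective,
because `(T p)(x) = (T (L_x p))(1)` on the span and a complex polynomial vanishing everywhere is
zero. [folklore] -/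
private theorem rank_span_matTransl_domRestrict_le_of_forall_mem {n : ℕ}
    (V : Submodule ℂ (MvPolynomial (Fin n × Fin n) ℂ)) [Module.Finite ℂ V]
    (L : (Fin n × Fin n → ℂ) →
      MvPolynomial (Fin n × Fin n) ℂ →ₐ[ℂ] MvPolynomial (Fin n × Fin n) ℂ)
    (hL : ∀ x, L x = aeval (fun ij : Fin n × Fin n =>
      (∑ l, x (ij.1, l) • X (l, ij.2) : MvPolynomial (Fin n × Fin n) ℂ)))
    (hV : ∀ (x : Fin n × Fin n → ℂ) (p : MvPolynomial (Fin n × Fin n) ℂ), p ∈ V → L x p ∈ V) :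
    Module.rank ℂ (Submodule.span ℂ (Set.range fun g : GL (Fin n) ℂ =>
      (matTransl (Fin n) ℂ (g : Matrix (Fin n) (Fin n) ℂ)).toLinearMap.domRestrict V)) ≤
      Module.rank ℂ V := by
  -- evaluation at the identity matrix `e`, and `Ψ T = ev₁ ∘ T`
  obtain ⟨e, he⟩ :
      ∃ e : Fin n × Fin n → ℂ, e = fun ij => (1 : Matrix (Fin n) (Fin n) ℂ) ij.1 ij.2 :=
    ⟨_, rfl⟩
  obtain ⟨Ψ, hΨ⟩ : ∃ Ψ : (V →ₗ[ℂ] MvPolynomial (Fin n × Fin n) ℂ) →ₗ[ℂ] Module.Dual ℂ V,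
      ∀ T q, Ψ T q = eval e (T q) :=
    ⟨LinearMap.llcomp ℂ V (MvPolynomial (Fin n × Fin n) ℂ) ℂ (aeval e).toLinearMap,
      fun T q => rfl⟩
  -- (★): `(T p)(x) = (T (L_x p))(1)` for every `T` in the span
  have key : ∀ T ∈ Submodule.span ℂ (Set.range fun g : GL (Fin n) ℂ =>
      (matTransl (Fin n) ℂ (g : Matrix (Fin n) (Fin n) ℂ)).toLinearMap.domRestrict V),
      ∀ (p : V) (x : Fin n × Fin n → ℂ),
        eval x (T p) = eval e (T ⟨L x (p : MvPolynomial (Fin n × Fin n) ℂ), hV x _ p.2⟩) := by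
    intro T hT
    induction hT using Submodule.span_induction with
    | mem T hT =>
      obtain ⟨g, rfl⟩ := hT
      intro p x
      exact eval_matTransl_eq_eval_one (g : Matrix (Fin n) (Fin n) ℂ) he (hL x) p
    | zero =>
      intro p x
      simp
    | add T₁ T₂ _ _ h₁ h₂ =>
      intro p x
      simp only [LinearMap.add_apply, map_add, h₁ p x, h₂ p x]
    | smul c T _ h =>
      intro p x
      simp only [LinearMap.smul_apply, smul_eval, h p x]
  -- injectivity of `Ψ` on the span
  have hinj : Function.Injective (Ψ.domRestrict (Submodule.span ℂ (Set.range
      fun g : GL (Fin n) ℂ =>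
        (matTransl (Fin n) ℂ (g : Matrix (Fin n) (Fin n) ℂ)).toLinearMap.domRestrict V))) := by
    rw [injective_iff_map_eq_zero]
    intro T h0
    apply Subtype.ext
    refine LinearMap.ext fun p => MvPolynomial.funext fun x => ?_
    have h1 := LinearMap.congr_fun h0 ⟨_, hV x _ p.2⟩
    rw [LinearMap.domRestrict_apply, hΨ, LinearMap.zero_apply] at h1
    rw [key T.1 T.2 p x, h1]
    simp
  refine (LinearMap.rank_le_of_injective _ hinj).trans_eq ?_
  rw [← Module.finrank_eq_rank ℂ (Module.Dual ℂ V), ← Module.finrank_eq_rank ℂ V,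
    Subspace.dual_finrank_eq]

/-- **Stub S5 (the image algebra is no bigger than the host).** The span of the right
translations `R_g = matTransl (Fin n) ℂ g`, `g ∈ GL_n(ℂ)`, restricted to `V = ℂ[x_{ij}]_{≤ s}`
(as maps `V → ℂ[x_{ij}]`), has rank at most `rank V`. Proof: `T ↦ (p ↦ (T p)(1))` is an
injective linear map from that span into `V^*` (every `T` in the span satisfies
`(T p)(x) = (T (L_x p))(1)` with the degree-preserving left substitution `(L_x p)(y) = p(x y)`, so
`(T ·)(1) = 0` forces all values of each `T p` to vanish and `T = 0` by `MvPolynomial.funext`),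
and `rank V^* = rank V` for the finite-dimensional `V`. [folklore] -/
theorem stub_rank_span_matTransl_domRestrict_le (n s : ℕ) :
    Module.rank ℂ (Submodule.span ℂ (Set.range fun g : GL (Fin n) ℂ =>
      (matTransl (Fin n) ℂ (g : Matrix (Fin n) (Fin n) ℂ)).toLinearMap.domRestrict
        (MvPolynomial.restrictTotalDegree (Fin n × Fin n) ℂ s))) ≤
      Module.rank ℂ (MvPolynomial.restrictTotalDegree (Fin n × Fin n) ℂ s) :=
  rank_span_matTransl_domRestrict_le_of_forall_mem _
    (fun x => aeval (fun ij : Fin n × Fin n =>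
      (∑ l, x (ij.1, l) • X (l, ij.2) : MvPolynomial (Fin n × Fin n) ℂ)))
    (fun _ => rfl) fun x p hp =>
    (mem_restrictTotalDegree _ _ _).2
      ((totalDegree_aeval_leftSubst_le x p).trans ((mem_restrictTotalDegree _ _ _).1 hp))

end Summit.MatrixMultiplication.MatrixMultiplication.Theorems

end
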